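import Literature.MathematicalPhysics.QuantumFieldTheory.Balaban1983to89.B11Ineq73KernelLettersLatticeFree
import Literature.MathematicalPhysics.QuantumFieldTheory.Balaban1983to89.B11Eq88LaplaceH1CurrentNorm
import Literature.MathematicalPhysics.QuantumFieldTheory.Balaban1983to89.B11Eq88LaplaceH1CurrentSymmetry
import Literature.MathematicalPhysics.QuantumFieldTheory.Balaban1983to89.B11Ineq88KernelLettersFlatChain
import Literature.MathematicalPhysics.QuantumFieldTheory.Balaban1983to89.B7Eq43AveragedSmallnessLevelFree

/-!
# `Balaban1983to89.B11Ineq98W80LettersFlatChain` — T. Bałaban, *The variational problem and background fields in renormalization group method for lattice gauge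
# theories*, Commun. Math. Phys. **102** (1985) 277–309 [Balaban1985Variational] (73) p. 289, (86)–(88) p. 291, Prop. 4 (97)–(98) pp. 292–293, (27) p. 282;
# [Balaban1985BackgroundPropagators] (3.122) p. 420, (3.126) p. 420, (3.132) p. 422: **THE ONE-BACKGROUND `W80`-LETTERS OF THE CHAIN's VACUUM PAIR IN THE CHAIN's
# SPELLING** — the kernel-column letters `θ_E`, `θ₃` (`B11Ineq73KernelLettersLatticeFree.exists_thetaE_theta3_latticeFree`), the composite-current norm `N₁`
# (`B11Eq88LaplaceH1CurrentNorm.exists_norm_current_laplaceH1_le`) and the (27)-symmetry `hsym` (`B11Eq88LaplaceH1CurrentSymmetry.pairSum_current_laplaceAkPi_sub_QaQ_comm`)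
# of the genuine (L3) slot, READ AT THE VACUUM `U ≡ 1` (print's class with `α = 0`, current `0`; [4] Prop. 2's data: the subgroup contains `1`, (52) holds with `pdev = 0`)
# and RESPELLED in the chain's letters (`B11Ineq88KernelLettersFlatChain.H1LatticeCLM_laplaceAkPi_one`, `B9Eq3119DeltaPiTowerFlat.laplaceAkPi_one_eq_laplaceAk_one`):
# they hold for `H_{1,k}(1) = H1LatticeCLM (flat data) φ hpos₁ hQ1`, `C_k(1)`, `Δ_π(1) = currentCLM φ lev₁ Dc (Δ_{a,k}(1) − Q_k(1)†aQ_k(1))` — the vacuum slot of this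
# lineage's two-background junction `B11Eq98W80TwoBackgroundLetters.norm_W80_sub_W80_le_pair` (binders `hΘ3₂`, `hΘE₂`, `hN₂`, `hsym₂`), with letter pairs `(B, δ)`,
# `(B₁, δ₁)` BEFORE the lattice (the SAME pairs serve at `U`).  NE9 crux-team LEAF PROVER 01 (`b2b-balaban-t4-ne9-formalise-leaf-01`), gen 105; cell `pub-balaban`∕`t4`,
# row NE9, bears_on R4/N22; composition BY NAME; [folklore].
WHAT IS PROVED (sorry-free; 0 `def`): `pairSum_current_flat_chain_comm` (`hsym` at the vacuum, unconditional), **`exists_W80letters_flat_chain`** (`∃ α₁ j₁ B δ B₁ δ₁` before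
the lattice: the three letters at `U` forwarded AND at the vacuum respelled).  HONEST SCOPE: bookkeeping over LANDED one-background letters at `U := 1`; the windows and
the Sect. C regime of the vacuum pair stay HYPOTHESES; nothing of [B11] (73), (88), Prop. 4 or [B9] (3.126), (3.132) asserted as printed; «NE9 ⇐ the named binders»; NE9
NOT PRINTED ∕ NOT PROVED; spine PROVED 0∕9; rung (B)+1 finite T⁴ — NOT infinite volume, NOT mass gap, NOT BetaPertH, NOT Clay.  HONEST DEPENDENCY: continuum YM on T⁴ ⇐
BetaPertH ∧ nine spine estimates (0/9 proved); BetaPertH ⇐ (D1) ∧ (D4) ∧ CAP+tail; G-an2-4 gates asym, D1 and NE2/3/4.  NEW file; nothing modified.  Net new unproved facts: 0.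
-/

noncomputable section

open scoped InnerProductSpace ComplexConjugate BigOperators

namespace Literature.MathematicalPhysics.QuantumFieldTheory.Balaban1983to89.B11Ineq98W80LettersFlatChain

open B4Sect5Torus (TSite tdist)
open B4Sect5Proof (latticeConst latticeConst_nonneg)
open B9SectCLatticeCarrier (Bond bpos shift unshift)
open B7Prop1Explicit (U1 Wcx boxVec)
open B11Eq103H1Complex (SiteL2K BondL2K H1LatticeCLM)
open B9Eq310DeltaPrime (plaqHolU plaqHolU_one)
open B9Eq310HessianOperator (adTransportW hessOp)
open B9Eq315QTorus (perCfg cornerSite)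
open B9Eq315QTower (towerP UlevOf)
open B9Eq315QTowerFlat (UlevOf_one perCfg_UlevOf_one_mem_U1 norm_Wcx_UlevOf_one_sub_one_le)
open B9Eq326OperatorTower (QkW laplaceAk RofUk)
open B9Eq324DeltaPrimeATower (laplacePrimeAk)
open B9Eq3119DeltaPiTower (laplaceAkPi)
open B9Eq3119DeltaPiTowerFlat (laplaceAkPi_one_eq_laplaceAk_one laplaceAkPi_one_pos_iff)
open B9Eq3119DeltaPiCarrier (currentCLM)
open B11Eq115Space
open B11Eq174Chart (Regime)
open B11Eq90Transpose (kernel)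
open B11Eq90V0primeCurrent (flat115)
open B11Eq80Current (Emap E3)
open B11Eq44COperatorTower (C2T)
open B11Eq44CLetterTower (Cck)
open B7Eq43AveragedSmallnessLevelFree (pdev_perCfg_le_of_plaq)
open B7Prop2Explicit (pdev AvgClosed C0 c2')
open B7Prop3Flat (c3)
open B7Prop5GeneralLevels (thetaGen C3Gen)
open B11Ineq73KernelLettersLatticeFree (exists_thetaE_theta3_latticeFree)
open B11Eq88LaplaceH1CurrentNorm (exists_norm_current_laplaceH1_le)
open B11Eq88LaplaceH1CurrentSymmetry (pairSum_current_laplaceAkPi_sub_QaQ_comm)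
open B11Ineq88KernelLettersFlatChain (J_flat_le_zero H1LatticeCLM_laplaceAkPi_one)

universe uκ

variable {d : ℕ} (hd : 1 ≤ d) (L : ℕ) [NeZero L] (hL : 1 ≤ L) (hL2 : 2 ≤ L) (hL3 : 3 ≤ L) [Fact (0 < (L : ℝ))]
  {𝔸 : Type*} [NormedRing 𝔸] [NormedAlgebra ℂ 𝔸] [CompleteSpace 𝔸] [NormOneClass 𝔸] [StarRing 𝔸] [NormedStarGroup 𝔸] [StarModule ℂ 𝔸] [FiniteDimensional ℂ 𝔸]
  {W : Type*} [NormedAddCommGroup W] [InnerProductSpace ℂ W] [FiniteDimensional ℂ W] (φ : W ≃ₗ[ℂ] 𝔸)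
  {Mφ Mφ' : ℝ} (hMφ : 0 ≤ Mφ) (hMφ' : 0 ≤ Mφ') (hφ : ∀ w, ‖φ w‖ ≤ Mφ * ‖w‖) (hφ' : ∀ X, ‖φ.symm X‖ ≤ Mφ' * ‖X‖) (hstar : ∀ X : 𝔸, ‖star X‖ ≤ ‖X‖)
  {a : ℝ} (ha : 0 < a) {a' : ℝ} (ha' : 0 < a') {ϱ : ℝ} (hϱ0 : 0 ≤ ϱ) (hϱ1 : ϱ < 1)
  (τ : 𝔸 →ₗ[ℂ] ℂ) {Cτ : ℝ} (hτ : ∀ X, ‖τ X‖ ≤ Cτ * ‖X‖) (hCτ : 0 ≤ Cτ) {Mτ : ℝ} (hτm : ∀ X Y : 𝔸, ‖τ (X * Y)‖ ≤ Mτ * ‖X‖ * ‖Y‖) (hMτ : 0 ≤ Mτ)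
  {ρw : ℝ} (hρw : 0 ≤ ρw)
  (hτ₁ : ∀ X : 𝔸, τ (star X) = conj (τ X)) (hτ₂ : ∀ X Y : 𝔸, τ (X * Y) = τ (Y * X)) (hφτ : ∀ X Y : 𝔸, ⟪φ.symm X, φ.symm Y⟫_ℂ = τ (star X * Y))
  (AQ : ℝ)
  {Gr : Subgroup 𝔸ˣ} (hGr : AvgClosed d L Gr) {α₀ : ℝ} (hα₀ : 0 < α₀) (hα3 : C0 d * α₀ ≤ 1 / 3) (hα4 : 4 * α₀ ≤ c2' d L)
  {ρ : ℝ} (hρ : Real.exp (4 * (800 * ((d : ℝ) + 1) ^ 2 * ((d : ℝ) + 4)) * α₀) * (1 + 8 * (131072 * ((d : ℝ) + 1) ^ 2) * ρ) ≤ 2)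
  (hρ4 : 4 * ρ ≤ c3 d L) (hθ : 2 * d * thetaGen d L α₀ ≤ (L : ℝ) ^ 3 / 16) (hC3 : 2 * d * C3Gen d L * ρ ≤ 1)

/-! ## §1 The (27)-symmetry of the vacuum's `Δ_π(1)` in the chain's spelling -/

section Sym

variable (m : Fin d → ℕ) [∀ i, NeZero (m i)] (n : ℕ) (η : ℝ) [Fact (0 < η)] {c₀ c₁ : ℝ} [Fact (0 < c₀)] [Fact (0 < c₁)]
  (hpos'₁ : ∀ x : SiteL2K ℂ d (towerP L m (n + 1)) c₀ W, x ≠ 0 →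
    0 < RCLike.re ⟪x, laplacePrimeAk L m n φ η (fun _ : Bond d (towerP L m (n + 1)) => (1 : 𝔸ˣ)) a' (c₁ := c₁) x⟫_ℂ)
  (lev₀ : Bond d (towerP L m (n + 1)) → ℕ) {κ' : Type*} [Fintype κ'] (lev₁ : κ' → ℕ) (Dc : (Bond d (towerP L m (n + 1)) → 𝔸) →ₗ[ℂ] (κ' → 𝔸))

omit [NormedStarGroup 𝔸] in
include hpos'₁ hφτ hτ₁ hτ₂ in
set_option maxRecDepth 8192 in
set_option maxHeartbeats 1600000 in
/-- **`hsym` AT THE VACUUM IN THE CHAIN's SPELLING**: `Σ_b τ((Δ_π(1)Y₁)(b)·Y₂(b)) = Σ_b τ((Δ_π(1)Y₂)(b)·Y₁(b))` for `Δ_π(1) = currentCLM φ lev₁ Dc (Δ_{a,k}(1) − Q_k(1)†aQ_k(1))`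
(the vacuum and all its level backgrounds are unitary; print's operator at `1` is the chain's). [cite: Balaban1985Variational, (27) p.282, (87)–(88) p.291; Balaban1985BackgroundPropagators, (3.122) p.420] -/
theorem pairSum_current_flat_chain_comm (Y₁ Y₂ : Space115 (L : ℝ) η lev₀ lev₁ Dc) :
    ∑ b' : Bond d (towerP L m (n + 1)), LinearMap.toContinuousLinearMap τ
        (NegSup.equiv (levWeight (L : ℝ) η lev₀ 3) 𝔸 ((currentCLM φ lev₁ Dc
                (laplaceAk L m n φ η (fun _ : Bond d (towerP L m (n + 1)) => (1 : 𝔸ˣ)) hL (fun _ => 0) (fun _ => by norm_num)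
                    (perCfg_UlevOf_one_mem_U1 L m (n + 1)) (norm_Wcx_UlevOf_one_sub_one_le L m (n + 1) (fun _ => 0) (fun _ => le_rfl)) τ (c₀ := c₀) (c₁ := c₁) a
                  - LinearMap.adjoint (QkW L m n φ (fun _ : Bond d (towerP L m (n + 1)) => (1 : 𝔸ˣ)) hL (fun _ => 0) (fun _ => by norm_num)
                      (perCfg_UlevOf_one_mem_U1 L m (n + 1)) (norm_Wcx_UlevOf_one_sub_one_le L m (n + 1) (fun _ => 0) (fun _ => le_rfl)) (c₀ := c₀) (c₁ := c₁)) ∘ₗ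
                      ((a : ℂ) • (QkW L m n φ (fun _ : Bond d (towerP L m (n + 1)) => (1 : 𝔸ˣ)) hL (fun _ => 0) (fun _ => by norm_num)
                        (perCfg_UlevOf_one_mem_U1 L m (n + 1)) (norm_Wcx_UlevOf_one_sub_one_le L m (n + 1) (fun _ => 0) (fun _ => le_rfl)) (c₀ := c₀) (c₁ := c₁))))) Y₁) b' * flat115 Y₂ b') =
      ∑ b' : Bond d (towerP L m (n + 1)), LinearMap.toContinuousLinearMap τ
        (NegSup.equiv (levWeight (L : ℝ) η lev₀ 3) 𝔸 ((currentCLM φ lev₁ Dc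
                (laplaceAk L m n φ η (fun _ : Bond d (towerP L m (n + 1)) => (1 : 𝔸ˣ)) hL (fun _ => 0) (fun _ => by norm_num)
                    (perCfg_UlevOf_one_mem_U1 L m (n + 1)) (norm_Wcx_UlevOf_one_sub_one_le L m (n + 1) (fun _ => 0) (fun _ => le_rfl)) τ (c₀ := c₀) (c₁ := c₁) a
                  - LinearMap.adjoint (QkW L m n φ (fun _ : Bond d (towerP L m (n + 1)) => (1 : 𝔸ˣ)) hL (fun _ => 0) (fun _ => by norm_num)
                      (perCfg_UlevOf_one_mem_U1 L m (n + 1)) (norm_Wcx_UlevOf_one_sub_one_le L m (n + 1) (fun _ => 0) (fun _ => le_rfl)) (c₀ := c₀) (c₁ := c₁)) ∘ₗ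
                      ((a : ℂ) • (QkW L m n φ (fun _ : Bond d (towerP L m (n + 1)) => (1 : 𝔸ˣ)) hL (fun _ => 0) (fun _ => by norm_num)
                        (perCfg_UlevOf_one_mem_U1 L m (n + 1)) (norm_Wcx_UlevOf_one_sub_one_le L m (n + 1) (fun _ => 0) (fun _ => le_rfl)) (c₀ := c₀) (c₁ := c₁))))) Y₂) b' * flat115 Y₁ b') := by
  have hUlev1 : ∀ (j : ℕ) (bb : Bond d (towerP L m (j + 1))), star (UlevOf L m (n + 1) (fun _ : Bond d (towerP L m (n + 1)) => (1 : 𝔸ˣ)) j bb : 𝔸) =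
      ((UlevOf L m (n + 1) (fun _ : Bond d (towerP L m (n + 1)) => (1 : 𝔸ˣ)) j bb)⁻¹ : 𝔸ˣ) := fun j bb => by rw [UlevOf_one]; simp
  have hUst1 : ∀ bb : Bond d (towerP L m (n + 1)), star ((fun _ : Bond d (towerP L m (n + 1)) => (1 : 𝔸ˣ)) bb : 𝔸) =
      ((((fun _ : Bond d (towerP L m (n + 1)) => (1 : 𝔸ˣ)) bb)⁻¹ : 𝔸ˣ) : 𝔸) := fun _ => by simp
  have h := pairSum_current_laplaceAkPi_sub_QaQ_comm L m n φ τ η hUlev1 hUst1 hφτ hτ₁ hτ₂ a' hpos'₁ hL (fun _ => 0) (fun _ => by norm_num)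
    (perCfg_UlevOf_one_mem_U1 L m (n + 1)) (norm_Wcx_UlevOf_one_sub_one_le L m (n + 1) (fun _ => 0) (fun _ => le_rfl)) (Lr := (L : ℝ)) (lev₀ := lev₀) lev₁ Dc a Y₁ Y₂
  rw [laplaceAkPi_one_eq_laplaceAk_one] at h
  exact h

end Sym

/-! ## §2 `θ_E`, `θ₃`, `N₁` at `U` (forwarded) and at the vacuum (respelled), ONE letter set -/

set_option maxRecDepth 8192 in
set_option maxHeartbeats 6400000 in
include hd hL2 hL3 hMφ hMφ' hφ hφ' hstar ha ha' hϱ0 hϱ1 hτ hCτ hτm hMτ hρw hτ₁ hτ₂ hφτ hGr hα₀ hα3 hα4 hρ hρ4 hθ hC3 in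
/-- **THE ONE-BACKGROUND `W80`-LETTERS `θ_E`, `θ₃`, `N₁` AT THE VACUUM, IN THE CHAIN's SPELLING** — `∃ (α₁, j₁, B, δ, B₁, δ₁)` BEFORE the lattice (the SAME letters as at `U`:
`B11Ineq73KernelLettersLatticeFree`, `B11Eq88LaplaceH1CurrentNorm`), then (i) at every background `U` of print's class the three letters as landed (forwarded verbatim), and (ii) for
`0 ≤ AQ`, at the vacuum with any witnesses `hpos′₁, hpos₁, hQ1`, under the Sect. C regime of `(H_{1,k}(1), C_k(1))` and the kernel-route window: the `θ_E`- and `θ₃`-columns of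
`kernel E′_1`, `kernel E₃,₁` and `‖Δ_π(1)(H_{1,k}(1)X)‖ ≤ w̄₃(M_φB₁M_φ′dK_d(δ₁))w̲_B⁻¹‖X‖`.
[cite: Balaban1985Variational, (73) p.289, (86)–(88) p.291, Prop. 4 (97)–(98) pp.292–293; Balaban1985BackgroundPropagators, (3.126) p.420, (3.132) p.422, (3.122) p.420] -/
theorem exists_W80letters_flat_chain :
    ∃ α₁ j₁ B δ B₁ δ₁ : ℝ, 0 < α₁ ∧ 0 < j₁ ∧ 0 ≤ B ∧ 0 < δ ∧ 0 ≤ B₁ ∧ 0 < δ₁ ∧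
      (∀ (n : ℕ) (η : ℝ) (_hηL : η * (L : ℝ) ^ (n + 1) = 1) (c₀ c₁ : ℝ) [Fact (0 < c₀)] [Fact (0 < c₁)]
        (_hw : c₀ * ((L : ℝ) ^ (n + 1)) ^ d = c₁) (_hρ : |η| ^ d / c₀ ≤ ρw) (m : Fin d → ℕ) [∀ i, NeZero (m i)] (_hm : ∀ i, 1 ≤ m i)
        (U : Bond d (towerP L m (n + 1)) → 𝔸ˣ) (αU : ℕ → ℝ) (_hα0 : ∀ j, 0 ≤ αU j) (hα1 : ∀ j, αU j ≤ 1 / 64)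
        (hαL : ∀ j, 50 * (d + 1) * αU j * (L : ℝ) ^ d ≤ 1 / 2)
        (hU1 : ∀ (j : ℕ) (x : B7Prop1Explicit.Site d) (k : Fin d), perCfg (towerP L m (j + 1)) (UlevOf L m (n + 1) U j) x k ∈ U1 𝔸)
        (hreg : ∀ (j : ℕ) (y : TSite d (towerP L m j)) (k : Fin d) (ρ' : Fin d → Fin L),
          ‖((Wcx L (perCfg (towerP L m (j + 1)) (UlevOf L m (n + 1) U j)) (cornerSite L y) k (boxVec L ρ') : 𝔸ˣ) : 𝔸) - 1‖ ≤ αU j)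
        (εU : ℕ → ℝ) (_hεU : ∀ j, 0 ≤ εU j) (_hUε : ∀ (j : ℕ) (b : Bond d (towerP L m (j + 1))), ‖(UlevOf L m (n + 1) U j b : 𝔸) - 1‖ ≤ εU j)
        (_hLb : ∀ (j : ℕ) (b : Bond d (towerP L m (j + 1))), UlevOf L m (n + 1) U j b ∈ U1 𝔸)
        (α : ℝ) (_hα : 0 ≤ α) (_hαle : α ≤ α₁)
        (hUst : ∀ b, star (U b : 𝔸) = (((U b)⁻¹ : 𝔸ˣ) : 𝔸)) (_hUb : ∀ b, U b ∈ U1 𝔸) (_hUη : ∀ b, ‖(U b : 𝔸) - 1‖ ≤ α * η)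
        (_hpl : ∀ p : B9SectCLatticeCarrier.Plaq d (towerP L m (n + 1)), ‖(plaqHolU U p : 𝔸) - 1‖ ≤ α * η ^ 2)
        (_hUgrad : ∀ (x : TSite d (towerP L m (n + 1))) (μ : Fin d), ‖(U (x, μ) : 𝔸) - U (unshift μ x, μ)‖ ≤ α * η ^ 2)
        (_hRlev : ∀ (j : ℕ) (b : Bond d (towerP L m (j + 1))) (w : W), ‖adTransportW φ (UlevOf L m (n + 1) U j) b w‖ ≤ ‖w‖)
        (_hεg : ∀ j < n + 1, εU j ≤ α * ϱ ^ j) (_hAQ : ∑ j ∈ Finset.range (n + 1), αU j ≤ AQ)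
        (hpos' : ∀ x : SiteL2K ℂ d (towerP L m (n + 1)) c₀ W, x ≠ 0 → 0 < RCLike.re ⟪x, laplacePrimeAk L m n φ η U a' (c₁ := c₁) x⟫_ℂ)
        (hpos : ∀ x : BondL2K ℂ d (towerP L m (n + 1)) c₀ W, x ≠ 0 →
          0 < RCLike.re ⟪x, laplaceAk L m n φ η U hL αU hα1 hU1 hreg τ (c₀ := c₀) (c₁ := c₁) a x⟫_ℂ)
        (_hc₀η : c₀ = η ^ d) (j₀ : ℝ) (_hJ : ∀ μ y, ‖B9Eq39Adjoint.J (fun μ => B9Eq33CovDerivVector.shiftEquiv μ) (fun μ y => U (y, μ)) η μ y‖ ≤ j₀) (_hj : j₀ ≤ j₁)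
        (hposπ : ∀ x : BondL2K ℂ d (towerP L m (n + 1)) c₀ W, x ≠ 0 →
          0 < RCLike.re ⟪x, laplaceAkPi L m n φ τ η U a' hpos' hL αU hα1 hU1 hreg (c₁ := c₁) a x⟫_ℂ)
        (hQ : Function.Surjective (QkW L m n φ U hL αU hα1 hU1 hreg (c₀ := c₀) (c₁ := c₁)))
        (lev₀ : Bond d (towerP L m (n + 1)) → ℕ) {κ' : Type uκ} [Fintype κ'] (lev₁ : κ' → ℕ)
        (Dc : (Bond d (towerP L m (n + 1)) → 𝔸) →ₗ[ℂ] (κ' → 𝔸)) (levB : Bond d m → ℕ) [Fact (0 < η)]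
        (_hUG : ∀ (x : B7Prop1Explicit.Site d) (κ : Fin d), perCfg (towerP L m (n + 1)) U x κ ∈ Gr)
        (_h52 : pdev (perCfg (towerP L m (n + 1)) U) < α₀ * (((L : ℝ) ^ (n + 1))⁻¹) ^ 2) (_hlev : ∀ b, n + 1 ≤ lev₀ b)
        {bH aC εC : ℝ} (_RC : Regime (H1LatticeCLM (L := (L : ℝ)) (η := η) (lev₀ := lev₀) (levB := levB) φ hposπ hQ lev₁ Dc) 0
          (Cck L m η (n + 1) U lev₀ lev₁ Dc levB) bH 0 (C2T d α₀) ρ 0 aC εC)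
        (_haC : 0 < aC) (_hεa : εC + aC ≤ ρ) {ϖ : ℝ} (_hϖ0 : 0 ≤ ϖ)
        (_hϖ : ∀ bb b' : Bond d (towerP L m (n + 1)), levWeight (L : ℝ) η lev₀ 3 bb / levWeight (L : ℝ) η lev₀ 3 b' ≤ ϖ)
        (_hq : (εC + aC) * (Mφ * B * Mφ' * (d * latticeConst d δ)) * (C3Gen d L * (2 ^ d * (2 * d))) ≤ 1 / 2),
        (∀ A' : Space115 (L : ℝ) η lev₀ lev₁ Dc, ‖A'‖ < aC → ∀ bb : Bond d (towerP L m (n + 1)), ∑ b' : Bond d (towerP L m (n + 1)),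
            levWeight (L : ℝ) η lev₀ 3 bb / levWeight (L : ℝ) η lev₀ 3 b' *
              ‖kernel (fderiv ℂ (Emap (H1LatticeCLM (L := (L : ℝ)) (η := η) (lev₀ := lev₀) (levB := levB) φ hposπ hQ lev₁ Dc)
                (Cck L m η (n + 1) U lev₀ lev₁ Dc levB) εC) A') b' bb‖ ≤ 2 * (ϖ * (Mφ * B * Mφ' * (d * latticeConst d δ))) * (C3Gen d L * (2 ^ d * (2 * d))) * (1 / (1 - 4 * bH * C2T d α₀ * (εC + aC))) * ‖A'‖) ∧
        (∀ A' : Space115 (L : ℝ) η lev₀ lev₁ Dc, ‖A'‖ < aC → ∀ bb : Bond d (towerP L m (n + 1)), ∑ b' : Bond d (towerP L m (n + 1)),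
            levWeight (L : ℝ) η lev₀ 3 bb / levWeight (L : ℝ) η lev₀ 3 b' *
              ‖kernel (fderiv ℂ (E3 (H1LatticeCLM (L := (L : ℝ)) (η := η) (lev₀ := lev₀) (levB := levB) φ hposπ hQ lev₁ Dc)
                (Cck L m η (n + 1) U lev₀ lev₁ Dc levB) εC) A') b' bb‖ ≤ (2 * (1 / (1 - 4 * bH * C2T d α₀ * (εC + aC))) + 1) * (ϖ * (Mφ * B * Mφ' * (d * latticeConst d δ))) * (C3Gen d L * (2 ^ d * (2 * d))) / aC * ‖A'‖ ^ 2) ∧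
        (∀ X : NegSize (L : ℝ) η levB 0 𝔸,
            ‖currentCLM φ lev₁ Dc
                (laplaceAkPi L m n φ τ η U a' hpos' hL αU hα1 hU1 hreg (c₁ := c₁) a
                  - LinearMap.adjoint (QkW L m n φ U hL αU hα1 hU1 hreg (c₀ := c₀) (c₁ := c₁)) ∘ₗ
                      ((a : ℂ) • QkW L m n φ U hL αU hα1 hU1 hreg (c₀ := c₀) (c₁ := c₁)))
                (H1LatticeCLM (L := (L : ℝ)) (η := η) (lev₀ := lev₀) (levB := levB) φ hposπ hQ lev₁ Dc X)‖ ≤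
              (NegSup.wSup (levWeight (L : ℝ) η lev₀ 3) : ℝ) * (Mφ * B₁ * Mφ' * (d * latticeConst d δ₁)) * (NegSup.wInvSup (levWeight (L : ℝ) η levB 0) : ℝ) * ‖X‖)) ∧
      (0 ≤ AQ → ∀ (n : ℕ) (η : ℝ) [Fact (0 < η)] (_hηL : η * (L : ℝ) ^ (n + 1) = 1) (c₀ c₁ : ℝ) [Fact (0 < c₀)] [Fact (0 < c₁)]
        (_hw : c₀ * ((L : ℝ) ^ (n + 1)) ^ d = c₁) (_hρ : |η| ^ d / c₀ ≤ ρw) (m : Fin d → ℕ) [∀ i, NeZero (m i)] (_hm : ∀ i, 1 ≤ m i)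
        (hpos'₁ : ∀ x : SiteL2K ℂ d (towerP L m (n + 1)) c₀ W, x ≠ 0 →
          0 < RCLike.re ⟪x, laplacePrimeAk L m n φ η (fun _ : Bond d (towerP L m (n + 1)) => (1 : 𝔸ˣ)) a' (c₁ := c₁) x⟫_ℂ)
        (hpos₁ : ∀ x : BondL2K ℂ d (towerP L m (n + 1)) c₀ W, x ≠ 0 →
          0 < RCLike.re ⟪x, laplaceAk L m n φ η (fun _ : Bond d (towerP L m (n + 1)) => (1 : 𝔸ˣ)) hL (fun _ => 0) (fun _ => by norm_num)
            (perCfg_UlevOf_one_mem_U1 L m (n + 1)) (norm_Wcx_UlevOf_one_sub_one_le L m (n + 1) (fun _ => 0) (fun _ => le_rfl)) τ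
            (c₀ := c₀) (c₁ := c₁) a x⟫_ℂ)
        (_hc₀η : c₀ = η ^ d)
        (hQ1 : Function.Surjective (QkW L m n φ (fun _ : Bond d (towerP L m (n + 1)) => (1 : 𝔸ˣ)) hL (fun _ => 0) (fun _ => by norm_num)
          (perCfg_UlevOf_one_mem_U1 L m (n + 1)) (norm_Wcx_UlevOf_one_sub_one_le L m (n + 1) (fun _ => 0) (fun _ => le_rfl)) (c₀ := c₀) (c₁ := c₁)))
        (lev₀ : Bond d (towerP L m (n + 1)) → ℕ) {κ' : Type uκ} [Fintype κ'] (lev₁ : κ' → ℕ)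
        (Dc : (Bond d (towerP L m (n + 1)) → 𝔸) →ₗ[ℂ] (κ' → 𝔸)) (levB : Bond d m → ℕ) (_hlev : ∀ b, n + 1 ≤ lev₀ b)
        {bH aC εC : ℝ} (_RC₁ : Regime (H1LatticeCLM (L := (L : ℝ)) (η := η) (lev₀ := lev₀) (levB := levB) (c := ((η : ℂ))⁻¹)
              (R := adTransportW φ (fun _ : Bond d (towerP L m (n + 1)) => (1 : 𝔸ˣ)))
              (S := adTransportW φ fun _ : Bond d (towerP L m (n + 1)) => (1 : 𝔸ˣ)⁻¹) (Δ₁ := hessOp φ η (fun _ : Bond d (towerP L m (n + 1)) => (1 : 𝔸ˣ)) τ)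
              (Rr := RofUk L m n φ η (fun _ : Bond d (towerP L m (n + 1)) => (1 : 𝔸ˣ)))
              (Q := (QkW L m n φ (fun _ : Bond d (towerP L m (n + 1)) => (1 : 𝔸ˣ)) hL (fun _ => 0) (fun _ => by norm_num)
                (perCfg_UlevOf_one_mem_U1 L m (n + 1)) (norm_Wcx_UlevOf_one_sub_one_le L m (n + 1) (fun _ => 0) (fun _ => le_rfl)) (c₀ := c₀) (c₁ := c₁))) (a := a)
              φ hpos₁ hQ1 lev₁ Dc) 0
          (Cck L m η (n + 1) (fun _ : Bond d (towerP L m (n + 1)) => (1 : 𝔸ˣ)) lev₀ lev₁ Dc levB) bH 0 (C2T d α₀) ρ 0 aC εC)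
        (_haC : 0 < aC) (_hεa : εC + aC ≤ ρ) {ϖ : ℝ} (_hϖ0 : 0 ≤ ϖ)
        (_hϖ : ∀ bb b' : Bond d (towerP L m (n + 1)), levWeight (L : ℝ) η lev₀ 3 bb / levWeight (L : ℝ) η lev₀ 3 b' ≤ ϖ)
        (_hq : (εC + aC) * (Mφ * B * Mφ' * (d * latticeConst d δ)) * (C3Gen d L * (2 ^ d * (2 * d))) ≤ 1 / 2),
        (∀ A' : Space115 (L : ℝ) η lev₀ lev₁ Dc, ‖A'‖ < aC → ∀ bb : Bond d (towerP L m (n + 1)), ∑ b' : Bond d (towerP L m (n + 1)),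
            levWeight (L : ℝ) η lev₀ 3 bb / levWeight (L : ℝ) η lev₀ 3 b' *
              ‖kernel (fderiv ℂ (Emap (H1LatticeCLM (L := (L : ℝ)) (η := η) (lev₀ := lev₀) (levB := levB) (c := ((η : ℂ))⁻¹)
              (R := adTransportW φ (fun _ : Bond d (towerP L m (n + 1)) => (1 : 𝔸ˣ)))
              (S := adTransportW φ fun _ : Bond d (towerP L m (n + 1)) => (1 : 𝔸ˣ)⁻¹) (Δ₁ := hessOp φ η (fun _ : Bond d (towerP L m (n + 1)) => (1 : 𝔸ˣ)) τ)
              (Rr := RofUk L m n φ η (fun _ : Bond d (towerP L m (n + 1)) => (1 : 𝔸ˣ)))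
              (Q := (QkW L m n φ (fun _ : Bond d (towerP L m (n + 1)) => (1 : 𝔸ˣ)) hL (fun _ => 0) (fun _ => by norm_num)
                (perCfg_UlevOf_one_mem_U1 L m (n + 1)) (norm_Wcx_UlevOf_one_sub_one_le L m (n + 1) (fun _ => 0) (fun _ => le_rfl)) (c₀ := c₀) (c₁ := c₁))) (a := a)
              φ hpos₁ hQ1 lev₁ Dc)
                (Cck L m η (n + 1) (fun _ : Bond d (towerP L m (n + 1)) => (1 : 𝔸ˣ)) lev₀ lev₁ Dc levB) εC) A') b' bb‖ ≤ 2 * (ϖ * (Mφ * B * Mφ' * (d * latticeConst d δ))) * (C3Gen d L * (2 ^ d * (2 * d))) * (1 / (1 - 4 * bH * C2T d α₀ * (εC + aC))) * ‖A'‖) ∧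
        (∀ A' : Space115 (L : ℝ) η lev₀ lev₁ Dc, ‖A'‖ < aC → ∀ bb : Bond d (towerP L m (n + 1)), ∑ b' : Bond d (towerP L m (n + 1)),
            levWeight (L : ℝ) η lev₀ 3 bb / levWeight (L : ℝ) η lev₀ 3 b' *
              ‖kernel (fderiv ℂ (E3 (H1LatticeCLM (L := (L : ℝ)) (η := η) (lev₀ := lev₀) (levB := levB) (c := ((η : ℂ))⁻¹)
              (R := adTransportW φ (fun _ : Bond d (towerP L m (n + 1)) => (1 : 𝔸ˣ)))
              (S := adTransportW φ fun _ : Bond d (towerP L m (n + 1)) => (1 : 𝔸ˣ)⁻¹) (Δ₁ := hessOp φ η (fun _ : Bond d (towerP L m (n + 1)) => (1 : 𝔸ˣ)) τ)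
              (Rr := RofUk L m n φ η (fun _ : Bond d (towerP L m (n + 1)) => (1 : 𝔸ˣ)))
              (Q := (QkW L m n φ (fun _ : Bond d (towerP L m (n + 1)) => (1 : 𝔸ˣ)) hL (fun _ => 0) (fun _ => by norm_num)
                (perCfg_UlevOf_one_mem_U1 L m (n + 1)) (norm_Wcx_UlevOf_one_sub_one_le L m (n + 1) (fun _ => 0) (fun _ => le_rfl)) (c₀ := c₀) (c₁ := c₁))) (a := a)
              φ hpos₁ hQ1 lev₁ Dc)
                (Cck L m η (n + 1) (fun _ : Bond d (towerP L m (n + 1)) => (1 : 𝔸ˣ)) lev₀ lev₁ Dc levB) εC) A') b' bb‖ ≤ (2 * (1 / (1 - 4 * bH * C2T d α₀ * (εC + aC))) + 1) * (ϖ * (Mφ * B * Mφ' * (d * latticeConst d δ))) * (C3Gen d L * (2 ^ d * (2 * d))) / aC * ‖A'‖ ^ 2) ∧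
        (∀ X : NegSize (L : ℝ) η levB 0 𝔸,
            ‖(currentCLM φ lev₁ Dc
                (laplaceAk L m n φ η (fun _ : Bond d (towerP L m (n + 1)) => (1 : 𝔸ˣ)) hL (fun _ => 0) (fun _ => by norm_num)
                    (perCfg_UlevOf_one_mem_U1 L m (n + 1)) (norm_Wcx_UlevOf_one_sub_one_le L m (n + 1) (fun _ => 0) (fun _ => le_rfl)) τ (c₀ := c₀) (c₁ := c₁) a
                  - LinearMap.adjoint (QkW L m n φ (fun _ : Bond d (towerP L m (n + 1)) => (1 : 𝔸ˣ)) hL (fun _ => 0) (fun _ => by norm_num)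
                      (perCfg_UlevOf_one_mem_U1 L m (n + 1)) (norm_Wcx_UlevOf_one_sub_one_le L m (n + 1) (fun _ => 0) (fun _ => le_rfl)) (c₀ := c₀) (c₁ := c₁)) ∘ₗ
                      ((a : ℂ) • (QkW L m n φ (fun _ : Bond d (towerP L m (n + 1)) => (1 : 𝔸ˣ)) hL (fun _ => 0) (fun _ => by norm_num)
                        (perCfg_UlevOf_one_mem_U1 L m (n + 1)) (norm_Wcx_UlevOf_one_sub_one_le L m (n + 1) (fun _ => 0) (fun _ => le_rfl)) (c₀ := c₀) (c₁ := c₁)))))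
                ((H1LatticeCLM (L := (L : ℝ)) (η := η) (lev₀ := lev₀) (levB := levB) (c := ((η : ℂ))⁻¹)
              (R := adTransportW φ (fun _ : Bond d (towerP L m (n + 1)) => (1 : 𝔸ˣ)))
              (S := adTransportW φ fun _ : Bond d (towerP L m (n + 1)) => (1 : 𝔸ˣ)⁻¹) (Δ₁ := hessOp φ η (fun _ : Bond d (towerP L m (n + 1)) => (1 : 𝔸ˣ)) τ)
              (Rr := RofUk L m n φ η (fun _ : Bond d (towerP L m (n + 1)) => (1 : 𝔸ˣ)))
              (Q := (QkW L m n φ (fun _ : Bond d (towerP L m (n + 1)) => (1 : 𝔸ˣ)) hL (fun _ => 0) (fun _ => by norm_num)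
                (perCfg_UlevOf_one_mem_U1 L m (n + 1)) (norm_Wcx_UlevOf_one_sub_one_le L m (n + 1) (fun _ => 0) (fun _ => le_rfl)) (c₀ := c₀) (c₁ := c₁))) (a := a)
              φ hpos₁ hQ1 lev₁ Dc) X)‖ ≤
              (NegSup.wSup (levWeight (L : ℝ) η lev₀ 3) : ℝ) * (Mφ * B₁ * Mφ' * (d * latticeConst d δ₁)) * (NegSup.wInvSup (levWeight (L : ℝ) η levB 0) : ℝ) * ‖X‖)) := by
  classical
  obtain ⟨α₁, j₁, B, δ, hα₁, hj₁, hB, hδ, HΘ⟩ :=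
    exists_thetaE_theta3_latticeFree hd L hL hL3 φ hMφ hMφ' hφ hφ' hstar ha ha' hϱ0 hϱ1 τ hτ hCτ hτm hMτ hρw hτ₁ hτ₂ hφτ AQ
  obtain ⟨α₁', j₁', B₁, δ₁, hα₁', hj₁', hB₁, hδ₁, HN⟩ :=
    exists_norm_current_laplaceH1_le hd L hL hL3 φ hMφ hMφ' hφ hφ' hstar ha ha' hϱ0 hϱ1 τ hτ hCτ hτm hMτ hρw hτ₁ hτ₂ hφτ AQ
  refine ⟨min α₁ α₁', min j₁ j₁', B, δ, B₁, δ₁, lt_min hα₁ hα₁', lt_min hj₁ hj₁', hB, hδ, hB₁, hδ₁, ?_, ?_⟩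
  · intro n η hηL c₀ c₁ _ _ hw hρ' m _ hm U αU hα0 hα1 hαL hU1 hreg εU hεU hUε hLb α hα hαle hUst hUb hUη hpl hUgrad hRlev hεg hAQ hpos' hpos hc₀η j₀ hJ hj
      hposπ hQ lev₀ κ' _ lev₁ Dc levB _ hUG h52 hlev bH aC εC RC haC hεa ϖ hϖ0 hϖ hq
    obtain ⟨hΘE, hΘ3⟩ := HΘ n η hηL c₀ c₁ hw hρ' m hm U αU hα0 hα1 hαL hU1 hreg εU hεU hUε hLb α hα (hαle.trans (min_le_left _ _)) hUst hUb hUη hpl hUgrad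
      hRlev hεg hAQ hpos' hpos hc₀η j₀ hJ (hj.trans (min_le_left _ _)) hposπ hQ lev₀ lev₁ Dc levB hL2 hGr hUG hα₀ hα3 hα4 h52 hlev hρ hρ4 hθ hC3 RC haC hεa hϖ0 hϖ hq
    refine ⟨fun A' hA' bb => (hΘE A' hA' bb).trans (le_of_eq (by ring)), fun A' hA' bb => (hΘ3 A' hA' bb).trans (le_of_eq (by ring)), fun X => ?_⟩
    exact HN n η hηL c₀ c₁ hw hρ' m hm U αU hα0 hα1 hαL hU1 hreg εU hεU hUε hLb α hα (hαle.trans (min_le_right _ _)) hUst hUb hUη hpl hUgrad hRlev hεg hAQ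
      hpos' hpos hc₀η j₀ hJ (hj.trans (min_le_right _ _)) hposπ hQ lev₀ lev₁ Dc levB X
  · intro hAQ n η _ hηL c₀ c₁ _ _ hw hρ' m _ hm hpos'₁ hpos₁ hc₀η hQ1 lev₀ κ' _ lev₁ Dc levB hlev bH aC εC RC₁ haC hεa ϖ hϖ0 hϖ hq
    -- the vacuum is in print's class with `α = 0`, `j₀ = 0`; [4] Prop. 2's data at the vacuum
    have hαL1 : ∀ j : ℕ, 50 * (d + 1) * (fun _ : ℕ => (0 : ℝ)) j * (L : ℝ) ^ d ≤ 1 / 2 := fun _ => by norm_num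
    have hUε1 : ∀ (j : ℕ) (b' : Bond d (towerP L m (j + 1))),
        ‖(UlevOf L m (n + 1) (fun _ : Bond d (towerP L m (n + 1)) => (1 : 𝔸ˣ)) j b' : 𝔸) - 1‖ ≤ (fun _ : ℕ => (0 : ℝ)) j := fun j b' => by
      rw [UlevOf_one]; simp
    have hLb1 : ∀ (j : ℕ) (b' : Bond d (towerP L m (j + 1))), UlevOf L m (n + 1) (fun _ : Bond d (towerP L m (n + 1)) => (1 : 𝔸ˣ)) j b' ∈ U1 𝔸 :=
      fun j b' => by rw [UlevOf_one]; exact one_mem _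
    have hRlev1 : ∀ (j : ℕ) (b' : Bond d (towerP L m (j + 1))) (w : W),
        ‖adTransportW φ (UlevOf L m (n + 1) (fun _ : Bond d (towerP L m (n + 1)) => (1 : 𝔸ˣ)) j) b' w‖ ≤ ‖w‖ := fun j b' w => by
      rw [UlevOf_one, B5Eq172HodgePositivity.adTransportW_one, LinearMap.id_apply]
    have hUst1 : ∀ b' : Bond d (towerP L m (n + 1)), star ((fun _ : Bond d (towerP L m (n + 1)) => (1 : 𝔸ˣ)) b' : 𝔸) =
        ((((fun _ : Bond d (towerP L m (n + 1)) => (1 : 𝔸ˣ)) b')⁻¹ : 𝔸ˣ) : 𝔸) := fun _ => by simp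
    have hUb1 : ∀ b' : Bond d (towerP L m (n + 1)), (fun _ : Bond d (towerP L m (n + 1)) => (1 : 𝔸ˣ)) b' ∈ U1 𝔸 := fun _ => one_mem _
    have hUη1 : ∀ b' : Bond d (towerP L m (n + 1)), ‖((fun _ : Bond d (towerP L m (n + 1)) => (1 : 𝔸ˣ)) b' : 𝔸) - 1‖ ≤ 0 * η := fun _ => by simp
    have hpl1 : ∀ p : B9SectCLatticeCarrier.Plaq d (towerP L m (n + 1)), ‖(plaqHolU (fun _ : Bond d (towerP L m (n + 1)) => (1 : 𝔸ˣ)) p : 𝔸) - 1‖ ≤ 0 * η ^ 2 :=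
      fun p => by rw [plaqHolU_one, Units.val_one, sub_self, norm_zero, zero_mul]
    have hUgrad1 : ∀ (x : TSite d (towerP L m (n + 1))) (μ : Fin d),
        ‖((fun _ : Bond d (towerP L m (n + 1)) => (1 : 𝔸ˣ)) (x, μ) : 𝔸) - (fun _ : Bond d (towerP L m (n + 1)) => (1 : 𝔸ˣ)) (unshift μ x, μ)‖ ≤ 0 * η ^ 2 :=
      fun x μ => by simp
    have hεg1 : ∀ j < n + 1, (fun _ : ℕ => (0 : ℝ)) j ≤ 0 * ϱ ^ j := fun _ _ => by simp
    have hAQ1 : ∑ j ∈ Finset.range (n + 1), (fun _ : ℕ => (0 : ℝ)) j ≤ AQ := by simpa using hAQ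
    have hJ1 := J_flat_le_zero L m n η (𝔸 := 𝔸)
    have hposπ₁ := (laplaceAkPi_one_pos_iff L m n φ τ η a' hpos'₁ hL (fun _ => 0) (fun _ => by norm_num)
      (perCfg_UlevOf_one_mem_U1 L m (n + 1)) (norm_Wcx_UlevOf_one_sub_one_le L m (n + 1) (fun _ => 0) (fun _ => le_rfl)) a (c₀ := c₀)).mpr hpos₁
    have hUG1 : ∀ (x : B7Prop1Explicit.Site d) (κ : Fin d), perCfg (towerP L m (n + 1)) (fun _ : Bond d (towerP L m (n + 1)) => (1 : 𝔸ˣ)) x κ ∈ Gr :=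
      fun x κ => by rw [B9Eq315QTorus.perCfg_apply]; exact Gr.one_mem
    have h52₁ : pdev (perCfg (towerP L m (n + 1)) (fun _ : Bond d (towerP L m (n + 1)) => (1 : 𝔸ˣ))) < α₀ * (((L : ℝ) ^ (n + 1))⁻¹) ^ 2 := by
      have hp := pdev_perCfg_le_of_plaq (U := fun _ : Bond d (towerP L m (n + 1)) => (1 : 𝔸ˣ)) (fun _ => one_mem _) le_rfl
        (fun p => by rw [plaqHolU_one, Units.val_one, sub_self, norm_zero])
      exact lt_of_le_of_lt hp (by positivity)
    -- the Sect. C regime of the vacuum pair in print's spelling (the supplier's binder)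
    have eH := H1LatticeCLM_laplaceAkPi_one L hL φ τ m n η hpos'₁ hpos₁ hposπ₁ hQ1 lev₀ levB lev₁ Dc
    have RC₁π : Regime (H1LatticeCLM (L := (L : ℝ)) (η := η) (lev₀ := lev₀) (levB := levB) φ hposπ₁ hQ1 lev₁ Dc) 0
        (Cck L m η (n + 1) (fun _ : Bond d (towerP L m (n + 1)) => (1 : 𝔸ˣ)) lev₀ lev₁ Dc levB) bH 0 (C2T d α₀) ρ 0 aC εC := by
      rw [eH]; exact RC₁
    obtain ⟨hΘE, hΘ3⟩ := HΘ n η hηL c₀ c₁ hw hρ' m hm (fun _ : Bond d (towerP L m (n + 1)) => (1 : 𝔸ˣ)) (fun _ => 0) (fun _ => le_rfl) (fun _ => by norm_num) hαL1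
      (perCfg_UlevOf_one_mem_U1 L m (n + 1)) (norm_Wcx_UlevOf_one_sub_one_le L m (n + 1) (fun _ => 0) (fun _ => le_rfl)) (fun _ => 0) (fun _ => le_rfl) hUε1 hLb1
      0 le_rfl hα₁.le hUst1 hUb1 hUη1 hpl1 hUgrad1 hRlev1 hεg1 hAQ1 hpos'₁ hpos₁ hc₀η 0 hJ1 hj₁.le hposπ₁ hQ1 lev₀ lev₁ Dc levB hL2 hGr hUG1 hα₀ hα3 hα4 h52₁
      hlev hρ hρ4 hθ hC3 RC₁π haC hεa hϖ0 hϖ hq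
    have hN := HN n η hηL c₀ c₁ hw hρ' m hm (fun _ : Bond d (towerP L m (n + 1)) => (1 : 𝔸ˣ)) (fun _ => 0) (fun _ => le_rfl) (fun _ => by norm_num) hαL1
      (perCfg_UlevOf_one_mem_U1 L m (n + 1)) (norm_Wcx_UlevOf_one_sub_one_le L m (n + 1) (fun _ => 0) (fun _ => le_rfl)) (fun _ => 0) (fun _ => le_rfl) hUε1 hLb1
      0 le_rfl hα₁'.le hUst1 hUb1 hUη1 hpl1 hUgrad1 hRlev1 hεg1 hAQ1 hpos'₁ hpos₁ hc₀η 0 hJ1 hj₁'.le hposπ₁ hQ1 lev₀ lev₁ Dc levB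
    -- respelled: `H̃_{1,k}(1) = H_{1,k}(1)` first (it carries the witness `hposπ₁`), then `Δ̃_{a,k}(1) = Δ_{a,k}(1)`
    rw [eH] at hΘE hΘ3 hN
    rw [laplaceAkPi_one_eq_laplaceAk_one] at hN
    exact ⟨fun A' hA' bb => (hΘE A' hA' bb).trans (le_of_eq (by ring)), fun A' hA' bb => (hΘ3 A' hA' bb).trans (le_of_eq (by ring)), hN⟩

end Literature.MathematicalPhysics.QuantumFieldTheory.Balaban1983to89.B11Ineq98W80LettersFlatChain

end
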